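import Mathlib
import Summits.CriticalPhenomena.SAWScalingLimit.Theorems.SAWRestrictionRigidityAxiomsOfLimitMarkovClockLocality
import Summits.CriticalPhenomena.SAWScalingLimit.Theorems.SAWRestrictionRigidityAxiomsOfLimitMarkovSimpleRigidity
import Summits.CriticalPhenomena.SAWScalingLimit.Theorems.SAWRestrictionRigidityAxiomsOfLimitMarkovPathSpaceMeasurable
import Literature.Probability.RandomPlanarGeometry.ChordalCurveFamilyProofs
import Summits.CriticalPhenomena.SAWScalingLimit.Theorems.SimpleSubseqLimits.Negative.SimpleSubseqLimitsFalseWithoutEndpointLimits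
import Literature.Probability.RandomPlanarGeometry.SimpleCurves
import HarnessLib

/-!
# The clock parametrisation of simple curve classes

Crux `AxiomsOfLimit` (stmt-CriticalPhenomena-1370), line `registered`, stub `stub_markovOfLimit`:
soft-Markov brick Λc "clock parametrisation of simple classes" (lead c4); registered sub-stub
`stub_clockParam`. Theorems only.

Fix a radius `R > 0`, put `W := volume (closedBall 0 R)`, let `clk γ s` be the intrinsic clock of
the head `γ|[0, s]` of a parametrised curve `γ` and `Λ γ r := γ (sInf {s | r W ≤ clk γ s - clk γ 0})`
its clock path (files `…IntrinsicClock`, `…ClockInverse`, `…ClockLocality`). The CLASS-LEVEL clock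
parametrisation `Λ : CurveClass ℂ → C([0,1], ℂ)` is the clock path of a chosen injective
representative on simple classes inside `ball 0 R`, and the constant path at the source elsewhere.
This file proves (`stub_clockParam`):

* `Λ c` is a representative of `c` for `c` simple in the ball (`Λ γ = γ ∘ θ` with `θ` a continuous
  monotone surjection of `[0, 1]`, and such traversals have the class of `γ`,
  `ClockParam.mk_eq_mk_of_monotone`);
* `Λ` of a constant class is the constant path (constant classes are not simple,
  `SimpleSubseqLimits.Negative.mk_const_not_mem_simple`);
* LOCALITY: `Λ (c.stopAt F)` is `Λ c` stopped at its own hitting parameter of `F`, and this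
  parameter times `W` is the clock of the past minus the clock of the source. The past `c.stopAt F`
  is the class of the head `γ|[0, h]` (`h` the hitting parameter of the injective representative
  `γ`); by rigidity of simple classes (`SimpleRigidity.exists_monotone_factor`) and
  reparametrisation invariance of the clock path (`stub_clockInverse` (B)) the value of `Λ` does
  not depend on the representative, so `Λ (c.stopAt F)` is the clock path of the head, which
  `stub_clockLocality` identifies with the clock path of `γ` frozen from clock `clk γ h - clk γ 0`
  on, i.e. from the hitting parameter of `Λ c` on (`stub_clockLocality`, HITTING, and the bridge
  `ClockParam.hitParam_eq_coe_sInf` between `Curve.hitParam` and the lattice infimum in `[0, 1]`);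
* Borel measurability of `Λ`, through the lift criterion `measurable_toPath_of_lift`: the lift
  `γ ↦ Λ (mk γ)` is, on the Borel set of parametrisations of simple classes in the ball, the clock
  path of `γ` itself (representative independence again), whose evaluations are Borel by
  `stub_clockInverse` (C), and `γ ↦ γ 0` off it.

References: G. F. Lawler, O. Schramm, W. Werner, Acta Math. 187 (2001), §2 (parametrisation of
initial segments by a functional of the hull); M. Aizenman, A. Burchard, Duke Math. J. 99 (1999),
§2.1 (the curve space). All [folklore].
-/

noncomputable section

open MeasureTheory Filter Topology Set Metric
open scoped ENNReal unitInterval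

namespace Summit.CriticalPhenomena.SAWScalingLimit.Theorems.AxiomsOfLimitMarkov

open Literature.Probability.RandomPlanarGeometry

/-! ### Two lemmas on curves and classes -/

/-- A monotone continuous traversal `γ ∘ θ` of a curve `γ` (`θ 0 = 0`, `θ 1 = 1`) has the class
of `γ` (`Curve.reparamDist_eq_zero_of_monotone'`). [folklore] -/
theorem ClockParam.mk_eq_mk_of_monotone {E : Type*} [PseudoMetricSpace E] (γ γ' : Curve E)
    {θ : I → I} (hθc : Continuous θ) (hθm : Monotone θ) (h0 : θ 0 = 0) (h1 : θ 1 = 1)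
    (h : ∀ t, γ' t = γ (θ t)) : CurveClass.mk γ' = CurveClass.mk γ := by
  refine CurveClass.mk_eq_mk.2 (Curve.reparamDist_eq_zero_of_monotone' (m := 1) zero_le_one
    (V := fun x => γ (Set.projIcc 0 1 zero_le_one x))
    (h₁ := fun x => (θ (Set.projIcc 0 1 zero_le_one x) : ℝ)) (h₂ := fun x => x)
    (γ.continuous.comp continuous_projIcc).continuousOn
    (continuous_subtype_val.comp (hθc.comp continuous_projIcc)) continuous_id
    (fun a b hab => Subtype.coe_le_coe.2 (hθm (Set.monotone_projIcc zero_le_one hab)))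
    (fun a b hab => hab) ?_ rfl ?_ rfl (fun t => ?_) (fun t => ?_))
  · exact (congrArg (fun s : I => ((θ s : I) : ℝ)) (Set.projIcc_left zero_le_one)).trans
      (congrArg Subtype.val h0)
  · exact (congrArg (fun s : I => ((θ s : I) : ℝ)) (Set.projIcc_right zero_le_one)).trans
      (congrArg Subtype.val h1)
  · simp only [Set.projIcc_val, h]
  · simp only [Set.projIcc_val]

/-- The first hitting parameter of `F` by a curve `δ` is (the real number underlying) the infimum,
in the complete lattice `[0, 1]`, of the parameters at which `δ` is in `F` (`sInf ∅ = 1`).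
[folklore] -/
theorem ClockParam.hitParam_eq_coe_sInf {E : Type*} [TopologicalSpace E] (F : Set E)
    (δ : Curve E) : δ.hitParam F = ((sInf {r : I | δ r ∈ F} : I) : ℝ) := by
  have hglb : IsGLB {r : I | δ r ∈ F} ⟨δ.hitParam F, δ.hitParam_mem_Icc F⟩ := by
    refine ⟨fun r hr => ?_, fun b hb => ?_⟩
    · show δ.hitParam F ≤ (r : ℝ)
      exact Curve.hitParam_le hr
    · show (b : ℝ) ≤ sInf (δ.hitSet F)
      refine le_csInf ⟨1, δ.one_mem_hitSet F⟩ ?_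
      rintro t (⟨ht, hmem⟩ | ht)
      · exact Subtype.coe_le_coe.2 (hb hmem)
      · rw [Set.mem_singleton_iff.1 ht]
        exact b.2.2
  exact congrArg Subtype.val (hglb.unique (isGLB_sInf _))

/-! ### Assembly -/

/-- **Λc, the clock parametrisation of simple classes** (crux `AxiomsOfLimit`, registered stub
`stub_clockParam`): for `R > 0`, `W := volume (closedBall 0 R)` and the clock
`clkc c := ∫ x in closedBall 0 R, exp (-infDist x c.range)` of a class, there is a Borel map
`Λ : CurveClass ℂ → C([0,1], ℂ)` such that `Λ c` represents `c` for every simple class `c` in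
`ball 0 R`, `Λ` of a constant class is the constant path, and (LOCALITY) for `c` simple in the
ball and a closed set `F` met by `c`, `Λ (c.stopAt F)` is `Λ c` stopped at its hitting parameter
of `F`, which times `W` equals `clkc (c.stopAt F) - clkc (const c.source)`. [folklore] -/
theorem stub_clockParam : ∀ [MeasurableSpace C(unitInterval, ℂ)] [BorelSpace C(unitInterval, ℂ)] (R : ℝ), 0 < R → let W : ℝ := (MeasureTheory.volume (Metric.closedBall (0:ℂ) R)).toReal; let clkc : Literature.Probability.RandomPlanarGeometry.CurveClass ℂ → ℝ := fun c => ∫ x in Metric.closedBall (0:ℂ) R, Real.exp (-Metric.infDist x c.range); ∃ Λ : Literature.Probability.RandomPlanarGeometry.CurveClass ℂ → C(unitInterval, ℂ), Measurable Λ ∧ (∀ c : Literature.Probability.RandomPlanarGeometry.CurveClass ℂ, c ∈ Literature.Probability.RandomPlanarGeometry.CurveClass.simple → c.range ⊆ Metric.ball (0:ℂ) R → Literature.Probability.RandomPlanarGeometry.CurveClass.mk (Literature.Probability.RandomPlanarGeometry.Curve.mk (Λ c)) = c) ∧ (∀ x : ℂ, Λ (Literature.Probability.RandomPlanarGeometry.CurveClass.mk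 (Literature.Probability.RandomPlanarGeometry.Curve.const x)) = ContinuousMap.const unitInterval x) ∧ (∀ c : Literature.Probability.RandomPlanarGeometry.CurveClass ℂ, c ∈ Literature.Probability.RandomPlanarGeometry.CurveClass.simple → c.range ⊆ Metric.ball (0:ℂ) R → ∀ F : Set ℂ, IsClosed F → (c.range ∩ F).Nonempty → Λ (c.stopAt F) = ((Λ c).comp (ContinuousMap.id unitInterval ⊓ ContinuousMap.const unitInterval (Set.projIcc (0:ℝ) 1 zero_le_one ((Literature.Probability.RandomPlanarGeometry.Curve.mk (Λ c)).hitParam F)))) ∧ ((Literature.Probability.RandomPlanarGeometry.Curve.mk (Λ c)).hitParam F) * W = clkc (c.stopAt F) - clkc (Literature.Probability.RandomPlanarGeometry.CurveClass.mk (Literature.Probability.RandomPlanarGeometry.Curve.const c.source))) := by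
  intro _ _ R hR W clkc
  classical
  -- the clock of heads and the clock path of a parametrised curve (as in `stub_clockInverse`)
  let clk : Curve ℂ → I → ℝ := fun γ s => ∫ x in closedBall (0 : ℂ) R, Real.exp (-infDist x
    (⟨γ.toContinuousMap.comp (Curve.affineClamp 0 s)⟩ : Curve ℂ).range)
  let L : Curve ℂ → I → ℂ := fun γ r => γ (sInf {s : I | (r : ℝ) * W ≤ clk γ s - clk γ 0})
  have hA : ∀ γ : Curve ℂ, Function.Injective γ → γ.range ⊆ ball (0 : ℂ) R →
      ∃ θ : I → I, Continuous θ ∧ Monotone θ ∧ θ 0 = 0 ∧ θ 1 = 1 ∧ ∀ r : I, L γ r = γ (θ r) :=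
    (stub_clockInverse R hR).1
  have hB : ∀ γ : Curve ℂ, Function.Injective γ → γ.range ⊆ ball (0 : ℂ) R →
      ∀ ψ : C(I, I), Monotone ψ → ψ 0 = 0 → ψ 1 = 1 →
        ∀ r : I, L ⟨γ.toContinuousMap.comp ψ⟩ r = L γ r :=
    (stub_clockInverse R hR).2.1
  have hC : ∀ r : I, Measurable fun γ : C(I, ℂ) => L (Curve.mk γ) r := fun r =>
    (stub_clockInverse R hR).2.2 r
  have hLoc : ∀ γ : Curve ℂ, Function.Injective γ → γ.range ⊆ ball (0 : ℂ) R → ∀ s₀ r : I,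
      ((r : ℝ) * W ≤ clk γ s₀ - clk γ 0 →
        L ⟨γ.toContinuousMap.comp (Curve.affineClamp 0 s₀)⟩ r = L γ r) ∧
      (clk γ s₀ - clk γ 0 ≤ (r : ℝ) * W →
        L ⟨γ.toContinuousMap.comp (Curve.affineClamp 0 s₀)⟩ r = γ s₀) :=
    (stub_clockLocality R hR).1
  have hHit : ∀ γ : Curve ℂ, Function.Injective γ → γ.range ⊆ ball (0 : ℂ) R → ∀ F : Set ℂ,
      IsClosed F → (∃ t, γ t ∈ F) → ((sInf {r : I | L γ r ∈ F} : I) : ℝ) * W =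
        clk γ (Set.projIcc 0 1 zero_le_one (γ.hitParam F)) - clk γ 0 :=
    (stub_clockLocality R hR).2
  have hW0 : 0 ≤ W := ENNReal.toReal_nonneg
  -- representative independence: every representative of a simple class has the clock path of
  -- the injective one (rigidity + reparametrisation invariance)
  have hinv : ∀ γ₀ : Curve ℂ, Function.Injective γ₀ → γ₀.range ⊆ ball (0 : ℂ) R →
      ∀ γ' : Curve ℂ, CurveClass.mk γ' = CurveClass.mk γ₀ → ∀ r, L γ' r = L γ₀ r := by
    intro γ₀ hinj hR' γ' hmk r
    obtain ⟨ψ, hψc, hψm, hψ0, hψ1, -, hψ⟩ :=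
      SimpleRigidity.exists_monotone_factor hinj (CurveClass.mk_eq_mk_iff_dist_eq_zero.1 hmk)
    have hγ' : γ' = ⟨γ₀.toContinuousMap.comp ⟨ψ, hψc⟩⟩ := DFunLike.ext _ _ hψ
    rw [hγ']
    exact hB γ₀ hinj hR' ⟨ψ, hψc⟩ hψm hψ0 hψ1 r
  have hLc : ∀ γ : Curve ℂ, Function.Injective γ → γ.range ⊆ ball (0 : ℂ) R →
      Continuous (L γ) := fun γ hγ hγR => by
    obtain ⟨θ, hθc, -, -, -, hθ⟩ := hA γ hγ hγR
    exact (γ.continuous.comp hθc).congr fun r => (hθ r).symm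
  -- a chosen injective representative of each simple class
  haveI : Nonempty (Curve ℂ) := ⟨Curve.const 0⟩
  have key : ∀ c : CurveClass ℂ, c ∈ CurveClass.simple →
      ∃ γ : Curve ℂ, Function.Injective γ ∧ CurveClass.mk γ = c := fun c hc => hc
  choose! rep hrep using key
  have hrepR : ∀ c : CurveClass ℂ, c ∈ CurveClass.simple ∧ c.range ⊆ ball (0 : ℂ) R →
      Function.Injective (rep c) ∧ (rep c).range ⊆ ball (0 : ℂ) R := fun c h =>
    ⟨(hrep c h.1).1, fun z hz => by
      have hz' : z ∈ c.range := by rw [← (hrep c h.1).2]; exact hz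
      exact h.2 hz'⟩
  -- the class-level clock parametrisation
  obtain ⟨Λ, hΛapply, hΛneg⟩ : ∃ Λ : CurveClass ℂ → C(I, ℂ),
      (∀ c, c ∈ CurveClass.simple ∧ c.range ⊆ ball (0 : ℂ) R → ∀ r, Λ c r = L (rep c) r) ∧
      (∀ c, ¬ (c ∈ CurveClass.simple ∧ c.range ⊆ ball (0 : ℂ) R) →
        Λ c = ContinuousMap.const I c.source) :=
    ⟨fun c => if h : c ∈ CurveClass.simple ∧ c.range ⊆ ball (0 : ℂ) R then
        ⟨L (rep c), hLc _ (hrepR c h).1 (hrepR c h).2⟩ else ContinuousMap.const I c.source,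
      fun c h r => by simp only [dif_pos h, ContinuousMap.coe_mk], fun c h => by simp only [dif_neg h]⟩
  have hconst : ∀ x : ℂ, Λ (CurveClass.mk (Curve.const x)) = ContinuousMap.const I x := fun x =>
    hΛneg _ fun h => SimpleSubseqLimits.Negative.mk_const_not_mem_simple x h.1
  refine ⟨Λ, ?_, fun c hc hcR => ?_, hconst, fun c hc hcR F hF hne => ?_⟩
  · -- Borel measurability through the lift `γ ↦ Λ (mk γ)`
    refine measurable_toPath_of_lift (ĝ := fun γ => Λ (CurveClass.mk (Curve.mk γ)))
      (measurable_toPath_of_eval fun r => ?_) fun _ => rfl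
    have hS : MeasurableSet {γ : C(I, ℂ) | CurveClass.mk (Curve.mk γ) ∈ CurveClass.simple ∧
        (CurveClass.mk (Curve.mk γ)).range ⊆ ball (0 : ℂ) R} :=
      (CurveClass.continuous_mk_comp_mk.measurable CurveClass.measurableSet_simple').inter
        (ContinuousMap.isOpen_setOf_range_subset isOpen_ball).measurableSet
    suffices heq : (fun γ : C(I, ℂ) => Λ (CurveClass.mk (Curve.mk γ)) r) = fun γ =>
        if CurveClass.mk (Curve.mk γ) ∈ CurveClass.simple ∧
          (CurveClass.mk (Curve.mk γ)).range ⊆ ball (0 : ℂ) R then L (Curve.mk γ) r else γ 0 by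
      rw [heq]
      exact Measurable.ite hS (hC r) (continuous_eval_const (0 : I)).measurable
    funext γ
    split_ifs with h
    · rw [hΛapply _ h]
      exact (hinv _ (hrepR _ h).1 (hrepR _ h).2 _ (hrep _ h.1).2.symm r).symm
    · rw [hΛneg _ h]
      rfl
  · -- `Λ c` represents `c`
    obtain ⟨hinj, hγR⟩ := hrepR c ⟨hc, hcR⟩
    obtain ⟨θ, hθc, hθm, hθ0, hθ1, hθ⟩ := hA _ hinj hγR
    exact (ClockParam.mk_eq_mk_of_monotone (rep c) _ hθc hθm hθ0 hθ1 fun t =>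
      (hΛapply c ⟨hc, hcR⟩ t).trans (hθ t)).trans (hrep c hc).2
  · -- LOCALITY
    obtain ⟨γ, hinj, hmk, hΛc⟩ : ∃ γ : Curve ℂ, Function.Injective γ ∧ CurveClass.mk γ = c ∧
        ∀ r, Λ c r = L γ r := ⟨rep c, (hrep c hc).1, (hrep c hc).2, hΛapply c ⟨hc, hcR⟩⟩
    subst hmk
    have hγR : γ.range ⊆ ball (0 : ℂ) R := hcR
    obtain ⟨x, hx, hxF⟩ := hne
    obtain ⟨t, rfl⟩ := Curve.mem_range.1 hx
    obtain ⟨t₀, ht₀⟩ : ∃ t₀ : I, (t₀ : ℝ) = γ.hitParam F := ⟨⟨_, γ.hitParam_mem_Icc F⟩, rfl⟩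
    have hproj : Set.projIcc (0 : ℝ) 1 zero_le_one (γ.hitParam F) = t₀ := by
      rw [← ht₀, Set.projIcc_val]
    -- the past is the class of the head `η := γ ∘ affineClamp 0 t₀`
    have hLocη := hLoc γ hinj hγR t₀
    have hstop : (CurveClass.mk γ).stopAt F =
        CurveClass.mk ⟨γ.toContinuousMap.comp (Curve.affineClamp 0 t₀)⟩ := by
      rw [CurveClass.stopAt_mk_holds F hF, Curve.stopAt_eq_of_coe_eq ht₀]
    have e1 : clkc (CurveClass.mk ⟨γ.toContinuousMap.comp (Curve.affineClamp 0 t₀)⟩) =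
        clk γ t₀ := rfl
    generalize hη : (⟨γ.toContinuousMap.comp (Curve.affineClamp 0 t₀)⟩ : Curve ℂ) = η
      at hLocη hstop e1
    have hηapply : ∀ s, η s = γ (t₀ * s) := fun s => by
      rw [← hη]
      exact StrictExtension.head_apply γ t₀ s
    -- `Λ` of the past is the clock path of the head
    have hΛη : ∀ r, Λ (CurveClass.mk η) r = L η r := by
      intro r
      rcases (unitInterval.nonneg' : (0 : I) ≤ t₀).eq_or_lt with ht0 | ht0
      · -- degenerate head: the constant class at the source
        have hηc : η = Curve.const (γ 0) := DFunLike.ext _ _ fun s => by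
          rw [hηapply, Curve.const_apply, ← ht0, zero_mul]
        rw [hηc, hconst]
        rfl
      · -- a genuine head: injective, in the ball, so `Λ` is the clock path of a representative
        have hηinj : Function.Injective η := fun s s' h => by
          rw [hηapply, hηapply] at h
          have h2 : (t₀ : ℝ) * s = t₀ * s' := congrArg Subtype.val (hinj h)
          exact Subtype.ext (mul_left_cancel₀ (unitInterval.coe_ne_zero.2 ht0.ne') h2)
        have hηR : η.range ⊆ ball (0 : ℂ) R := by
          rintro _ ⟨s, rfl⟩
          rw [hηapply]
          exact hγR ⟨_, rfl⟩
        have hc' : CurveClass.mk η ∈ CurveClass.simple ∧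
            (CurveClass.mk η).range ⊆ ball (0 : ℂ) R := ⟨CurveClass.mk_mem_simple hηinj, hηR⟩
        exact (hΛapply _ hc' r).trans (hinv η hηinj hηR _ (hrep _ hc'.1).2 r)
    -- the hitting parameter of the clock path
    obtain ⟨r₀, hr₀⟩ : ∃ r₀ : I, sInf {r : I | L γ r ∈ F} = r₀ := ⟨_, rfl⟩
    have hset : {r : I | (Curve.mk (Λ (CurveClass.mk γ))) r ∈ F} = {r : I | L γ r ∈ F} :=
      Set.ext fun r => by
        show Λ (CurveClass.mk γ) r ∈ F ↔ L γ r ∈ F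
        rw [hΛc r]
    have hρ : (Curve.mk (Λ (CurveClass.mk γ))).hitParam F = (r₀ : ℝ) := by
      rw [ClockParam.hitParam_eq_coe_sInf, hset, hr₀]
    have hr₀W : (r₀ : ℝ) * W = clk γ t₀ - clk γ 0 := by
      have h := hHit γ hinj hγR F hF ⟨t, hxF⟩
      rwa [hr₀, hproj] at h
    refine ⟨?_, ?_⟩
    · -- the stopped-path identity
      rw [hstop, hρ, Set.projIcc_val]
      refine ContinuousMap.ext fun r => ?_
      show Λ (CurveClass.mk η) r = Λ (CurveClass.mk γ) (r ⊓ r₀)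
      rw [hΛη r, hΛc]
      rcases le_total r r₀ with hle | hle
      · rw [inf_of_le_left hle]
        exact (hLocη r).1
          ((mul_le_mul_of_nonneg_right (Subtype.coe_le_coe.2 hle) hW0).trans_eq hr₀W)
      · rw [inf_of_le_right hle, (hLocη r).2
          (hr₀W.symm.trans_le (mul_le_mul_of_nonneg_right (Subtype.coe_le_coe.2 hle) hW0)),
          ← (hLocη r₀).2 hr₀W.ge]
        exact (hLocη r₀).1 hr₀W.le
    · -- the clock identity
      have e0 : clkc (CurveClass.mk (Curve.const (CurveClass.mk γ).source)) = clk γ 0 := by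
        have hK : (Curve.const (CurveClass.mk γ).source).range =
            (⟨γ.toContinuousMap.comp (Curve.affineClamp 0 (0 : I))⟩ : Curve ℂ).range := by
          rw [IntrinsicClock.range_head, Curve.range_const]
          simp only [zero_mul, Set.range_const, CurveClass.source_mk, Curve.source_def]
        exact congrArg (fun K : Set ℂ => ∫ x in closedBall (0 : ℂ) R, Real.exp (-infDist x K)) hK
      rw [hρ, hr₀W, hstop, e1, e0]

end Summit.CriticalPhenomena.SAWScalingLimit.Theorems.AxiomsOfLimitMarkov

end
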